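import Literature.Algebra.Module.LocalGlobalLattice
import Mathlib.LinearAlgebra.Matrix.GeneralLinearGroup.Defs
import HarnessLib

/-!
# Crux 4 (`BSDpOnCellC`), line telescope, leaf N1 `stub_branchLattice`: brick «B-iso», matrix half —
# a RATIONAL conjugacy `P ∈ GL_n(ℚ_p)` between two integral matrix representations yields an INTEGRAL
# intertwiner `Q` with an integral quasi-inverse `Q'`, `Q Q' = Q' Q = p^c`

The Galois-side fact text proposed for N1 (`Cruxes/BSDpOnCellC/T-GAL-FACTTEXT.md` §3, clauses (G-fib₀)/(G-fib_t)) states the fibres of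
the branch lattice as print does (Hida 1986 Thm. 2.1 (2.2c): «`π mod P` is equivalent to `π(f_P)`»): conjugate over the residue FIELD `ℚ_p` to
`T_pE ⊗ ℚ_p`, resp. to the member's self-dual lattice `⊗ K_t`. Leaf N1 (and x2-p2 g23's N1♭) consumes ISOGENIES of cofree modules with finite
kernel and cokernel. The passage is «clear the denominators of `P`»: this file proves the matrix statement — from `M₁(g) = P·M₂(g)·P⁻¹` in
`GL_n(ℚ_p)` with `M₁, M₂` integral, produce `Q, Q' ∈ M_n(ℤ_p)` and `c : ℕ` with `Q·Q' = Q'·Q = p^c·1`, `M₁(g)·Q = Q·M₂(g)` and `Q'·M₁(g) = M₂(g)·Q'`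
for all `g` (`exists_integral_intertwiner`; the denominators are cleared by the tree's `Literature.Algebra.Module.exists_norm_pow_mul_entries_le_one`). The module half (an integral `Q` with `Q'Q = p^c` acts on `(ℚ_p/ℤ_p)ⁿ` with kernel inside the finite
`p^c`-torsion and surjectively) is cofree-module plumbing left to the consumer. Helper only (`--supports stmt-BirchSwinnertonDyer-19034 --as helper`);
no registered stub, crux or summit statement is proved; BSD is proved for no curve.

References: [Hida1986] H. Hida, *Galois representations into `GL₂(ℤ_p[[X]])` attached to ordinary cusp forms*, Invent. Math. 85 (1986), Thm. 2.1
(2.2c) (fibres «equivalent», i.e. rationally conjugate). [Kieffer2024IsogenyGraphs] J. Kieffer, *Isogeny graphs of abelian varieties over finite fields* (2024) §1.2.2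
Prop. 1.2.5 (an isogeny = an injective map of Tate lattices with finite cokernel; rational = up to bounded denominators). [Gouvea1993PadicNumbers] F. Gouvêa,
*p-adic Numbers*, Cor. 4.2.4 («ℚ_p = ℤ_p[1/p]», i.e. for every `x ∈ ℚ_p` some `pⁿx ∈ ℤ_p`; held copy `book:gouvea1993-p-adic-numbers` p. 64).
-/

noncomputable section

set_option linter.dupNamespace false

namespace Summit.BirchSwinnertonDyer.BirchSwinnertonDyer.Theorems.TelescopeBranchIntegralIntertwiner

variable {p : ℕ} [Fact p.Prime]

/-- Clearing the denominators of two matrices at once (tree: `Literature.Algebra.Module.exists_norm_pow_mul_entries_le_one` +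
`exists_map_eq_of_norm_le`): for `A, B ∈ M_n(ℚ_p)` one power `p^a` makes both images of integral matrices.
[cite: Gouvea1993PadicNumbers, Cor. 4.2.4 (held copy p. 64)] -/
theorem exists_pow_smul_eq_map_coe {n : ℕ} (A B : Matrix (Fin n) (Fin n) ℚ_[p]) :
    ∃ (a : ℕ) (Q Q' : Matrix (Fin n) (Fin n) ℤ_[p]),
      Q.map ((↑) : ℤ_[p] → ℚ_[p]) = (p : ℚ_[p]) ^ a • A ∧ Q'.map ((↑) : ℤ_[p] → ℚ_[p]) = (p : ℚ_[p]) ^ a • B := by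
  obtain ⟨a, hA, hB⟩ := Literature.Algebra.Module.exists_norm_pow_mul_entries_le_one (p := p) A B
  obtain ⟨Q, hQ⟩ := Literature.Algebra.Module.exists_map_eq_of_norm_le (M := (p : ℚ_[p]) ^ a • A)
    (fun i j => by rw [Matrix.smul_apply, smul_eq_mul]; exact hA i j)
  obtain ⟨Q', hQ'⟩ := Literature.Algebra.Module.exists_map_eq_of_norm_le (M := (p : ℚ_[p]) ^ a • B)
    (fun i j => by rw [Matrix.smul_apply, smul_eq_mul]; exact hB i j)
  exact ⟨a, Q, Q', hQ, hQ'⟩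

/-- The coercion `M_n(ℤ_p) → M_n(ℚ_p)` is injective. [folklore] -/
theorem map_coe_injective {n : Type*} :
    Function.Injective fun M : Matrix n n ℤ_[p] => M.map ((↑) : ℤ_[p] → ℚ_[p]) :=
  fun M N h => Matrix.ext fun i j => PadicInt.ext (by
    have := congrArg (fun X : Matrix n n ℚ_[p] => X i j) h
    simpa using this)

/-- The coercion `M_n(ℤ_p) → M_n(ℚ_p)` as a ring homomorphism (`RingHom.mapMatrix` of `PadicInt.Coe.ringHom`). [folklore] -/
theorem map_coe_mul {n : Type*} [Fintype n] [DecidableEq n] (M N : Matrix n n ℤ_[p]) :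
    (M * N).map ((↑) : ℤ_[p] → ℚ_[p]) = M.map ((↑) : ℤ_[p] → ℚ_[p]) * N.map ((↑) : ℤ_[p] → ℚ_[p]) :=
  (PadicInt.Coe.ringHom (p := p)).mapMatrix.map_mul M N

/-- **Brick «B-iso», matrix half.** If two integral matrix representations `M₁, M₂ : G → M_n(ℤ_p)` are conjugate by `P ∈ GL_n(ℚ_p)`,
`M₁(g) = P M₂(g) P⁻¹`, then there are INTEGRAL `Q, Q'` and `c : ℕ` with `Q Q' = Q' Q = p^c · 1`, `M₁(g) Q = Q M₂(g)` and `Q' M₁(g) = M₂(g) Q'`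
for every `g` — `Q = p^a P`, `Q' = p^a P⁻¹`, `c = 2a`. [cite: Hida1986, Thm. 2.1 (2.2c)] [cite: Kieffer2024IsogenyGraphs, §1.2.2 Prop. 1.2.5] -/
theorem exists_integral_intertwiner {G : Type*} {n : ℕ}
    (M₁ M₂ : G → Matrix (Fin n) (Fin n) ℤ_[p]) (P : GL (Fin n) ℚ_[p])
    (h : ∀ g, (M₁ g).map ((↑) : ℤ_[p] → ℚ_[p]) =
      (P : Matrix (Fin n) (Fin n) ℚ_[p]) * (M₂ g).map ((↑) : ℤ_[p] → ℚ_[p]) * ((P⁻¹ : GL (Fin n) ℚ_[p]) : Matrix (Fin n) (Fin n) ℚ_[p])) :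
    ∃ (Q Q' : Matrix (Fin n) (Fin n) ℤ_[p]) (c : ℕ),
      Q * Q' = ((p : ℤ_[p]) ^ c) • (1 : Matrix (Fin n) (Fin n) ℤ_[p]) ∧ Q' * Q = ((p : ℤ_[p]) ^ c) • (1 : Matrix (Fin n) (Fin n) ℤ_[p]) ∧
      ∀ g, M₁ g * Q = Q * M₂ g ∧ Q' * M₁ g = M₂ g * Q' := by
  obtain ⟨a, Q, Q', hQ, hQ'⟩ := exists_pow_smul_eq_map_coe (P : Matrix (Fin n) (Fin n) ℚ_[p]) ((P⁻¹ : GL (Fin n) ℚ_[p]) : Matrix (Fin n) (Fin n) ℚ_[p])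
  have hPP : (P : Matrix (Fin n) (Fin n) ℚ_[p]) * ((P⁻¹ : GL (Fin n) ℚ_[p]) : Matrix (Fin n) (Fin n) ℚ_[p]) = 1 := by
    rw [← Units.val_mul, mul_inv_cancel, Units.val_one]
  have hP'P : ((P⁻¹ : GL (Fin n) ℚ_[p]) : Matrix (Fin n) (Fin n) ℚ_[p]) * (P : Matrix (Fin n) (Fin n) ℚ_[p]) = 1 := by
    rw [← Units.val_mul, inv_mul_cancel, Units.val_one]
  have hc : ((((p : ℤ_[p]) ^ (a + a)) • (1 : Matrix (Fin n) (Fin n) ℤ_[p])).map ((↑) : ℤ_[p] → ℚ_[p])) =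
      ((p : ℚ_[p]) ^ (a + a)) • (1 : Matrix (Fin n) (Fin n) ℚ_[p]) := by
    ext i j
    by_cases hij : i = j
    · subst hij; simp
    · simp [hij]
  refine ⟨Q, Q', a + a, map_coe_injective ?_, map_coe_injective ?_, fun g => ⟨map_coe_injective ?_, map_coe_injective ?_⟩⟩
  · change (Q * Q').map _ = (((p : ℤ_[p]) ^ (a + a)) • (1 : Matrix (Fin n) (Fin n) ℤ_[p])).map _
    rw [map_coe_mul, hQ, hQ', hc, smul_mul_smul_comm, hPP, ← pow_add]
  · change (Q' * Q).map _ = (((p : ℤ_[p]) ^ (a + a)) • (1 : Matrix (Fin n) (Fin n) ℤ_[p])).map _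
    rw [map_coe_mul, hQ, hQ', hc, smul_mul_smul_comm, hP'P, ← pow_add]
  · change (M₁ g * Q).map _ = (Q * M₂ g).map _
    rw [map_coe_mul, map_coe_mul, hQ, h g, Matrix.mul_smul, Matrix.smul_mul, Matrix.mul_assoc, Matrix.mul_assoc, hP'P, Matrix.mul_one]
  · change (Q' * M₁ g).map _ = (M₂ g * Q').map _
    rw [map_coe_mul, map_coe_mul, hQ', h g, Matrix.mul_smul, Matrix.smul_mul, ← Matrix.mul_assoc, ← Matrix.mul_assoc, hP'P, Matrix.one_mul]

end Summit.BirchSwinnertonDyer.BirchSwinnertonDyer.Theorems.TelescopeBranchIntegralIntertwiner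

end
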